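import Summits.QuantumFields.YangMills.Theorems.FluctuationComparisonRegPrIntLS2BetaDecayDoor
import Literature.Analysis.Matrix.LogDetMixedDifferenceExpLocalised
import Mathlib.LinearAlgebra.Determinant
import HarnessLib

/-!
# S2β · LAPLACE stub — letter DECAY, END TO END AS ONE DOOR: the clustering clause of (T) from the amplitude 4-point (`ε₁`) and a C¹ RECTANGLE of
# slice-Hessian MATRICES with exponentially localised variations and Combes–Thomas decay (`ε₂` by ✓`abs_fourPt_log_det_le_of_expLocalised`)

Cell `ym3-torus` (rung R3: continuum `SU(2)` Yang–Mills on `T³` — NOT `d = 4`, NOT infinite volume, NOT a mass gap, NOT Clay); width seat `ym-ust-20520-w4` g15;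
helper of the crux `stmt-QuantumFields-20520` (`--supports`, NOT a proof of it).  LAPLACE row of LINE g18-1, decomposition of record (T) = CHART∞ ∘ LIMIT ∘ KNIT ∘ DECAY.
After ✓KNIT and ✓LIMIT(-INST) the clustering clause reads `|fourPt (log ∘ C)| ≤ φ₁ J·e^{−κ d}` with `C x = ℓ x ∕ b`, `ℓ x = c₀ · P x ∕ √(LinearMap.det (Ah x))`
(`Ah x : Vt →ₗ[ℝ] Vt` the transversal Hessian at corner `x`, ONE transversal space `Vt` for the four corners — the «common slice» requirement).  THIS FILE is the
single door LIMIT-INST ∕ the docking edit can copy `stub_fourPtDecay`'s rows from (LINE OWNER WORD 12 (a)):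
* ✓(D2) `…S2BetaDecayDoor.abs_fourPt_log_oneLoopConst_le` supplies the split `ε₁ + ε₂∕2`;
* the Hessians are read as MATRICES in one basis `bι : Basis ι ℝ Vt` (`LinearMap.det (Ah x) = (toMatrix bι bι (Ah x)).det`, Mathlib `LinearMap.det_toMatrix`), and a
  two-parameter family `M : ℝ → ℝ → Matrix ι ι ℝ` with `M 0 0, M 1 0, M 0 1, M 1 1` = the four corner matrices (the Hessian of the action at the background of the
  interpolated datum — an S2β object, here a ROW) carries the hypotheses of px7 g9's ✓`Literature.Analysis.Matrix.abs_fourPt_log_det_le_of_expLocalised`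
  (C¹ in `s`, invertible, exponentially localised `∂ₛM(s,1)` ∕ `M(s,1) − M(s,0)` around two profiles `d, d'` separated by `R`, Combes–Thomas decay of `M(s,1)⁻¹`,
  a global bound on `M(s,0)⁻¹`, the mixed response `η`) ⟹ `ε₂ = |ι|⁴·α·ε·β₀·δ·e^{−θR} + |ι|²·β₀·η`.
★★`abs_fourPt_log_oneLoopConst_le_of_rectangle` — the composition.  (The Combes–Thomas row `hA` is dischargeable by ✓`coercive_combes_thomas_real` from a uniform
gap — ✓(L2 A) `inner_ge_of_quadratic_growth` gives `2c` — and range one; `η`, `δ`, `ε` by ✓`LocalisedResponse` ∕ `LocalisedVariation` from locality of the action.)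
HONEST SCOPE.  A door: the rectangle `M`, its localisation rows and the amplitude 4-point `ε₁` are hypotheses (the S2β residue of DECAY); nothing of DECAY-in-S2β ∕
LAPLACE ∕ S2β ∕ the crux 20520 is proved; `YM3TorusSU2` NOT proved; the Yang–Mills mass gap (Clay) NOT proved.  Def-free; default heartbeats.
References: [Balaban1985Variational] CMP 102 (1985) Thm 1 (8)–(10) p. 279; [Balaban1984PropagatorsII] CMP 96 (1984) (1.33); [GlimmJaffe1987] §18.2; [Breitung1994] Thm 41.
-/

noncomputable section

open Summit.QuantumFields.YangMills.Theorems.FluctuationComparisonRegPrIntLS2BetaDecayDoor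
open Literature.Analysis.Matrix

namespace Summit.QuantumFields.YangMills.Theorems.FluctuationComparisonRegPrIntLS2BetaDecayLogDet

variable {X : Type*} {Vt : Type*} [AddCommGroup Vt] [Module ℝ Vt]
variable {ι : Type*} [Fintype ι] [DecidableEq ι]

/-- ★★ **DECAY, END TO END, AS ONE DOOR.**  Corners `U V W Z : X`; one-loop constants `ℓ x = c₀ · P x ∕ √(det (Ah x))` (common `c₀ > 0`, `P x > 0`, `det (Ah x) > 0`);
KNIT's constant `C = ℓ ∕ b` (`b > 0`); the amplitude∕orbit-factor 4-point `|fourPt (log ∘ P)| ≤ ε₁`; a basis `bι` of the common transversal space and a C¹ rectangle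
`M(s,t)` of real `ι × ι` matrices with the four corner values `toMatrix bι bι (Ah ·)` carrying the rows of ✓`abs_fourPt_log_det_le_of_expLocalised`.  THEN
`|fourPt (log ∘ C)| ≤ ε₁ + (|ι|⁴·α·ε·β₀·δ·e^{−θR} + |ι|²·β₀·η) ∕ 2`. [cite: Balaban1985Variational, Thm 1 (8)-(10) p. 279] [cite: GlimmJaffe1987, §18.2]
[cite: Breitung1994, Thm 41 p. 56] -/
theorem abs_fourPt_log_oneLoopConst_le_of_rectangle
    {U V W Z : X} {ℓ P : X → ℝ} {Ah : X → (Vt →ₗ[ℝ] Vt)} {c₀ b ε₁ : ℝ} (hc : 0 < c₀) (hb : 0 < b)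
    (hℓ : ∀ x, x = U ∨ x = V ∨ x = W ∨ x = Z → ℓ x = c₀ * P x / Real.sqrt (LinearMap.det (Ah x)))
    (hP : ∀ x, x = U ∨ x = V ∨ x = W ∨ x = Z → 0 < P x)
    (hdet : ∀ x, x = U ∨ x = V ∨ x = W ∨ x = Z → 0 < LinearMap.det (Ah x))
    (h₁ : |(Real.log (P U) - Real.log (P V)) - (Real.log (P W) - Real.log (P Z))| ≤ ε₁)
    -- the slice-Hessian matrix rectangle
    (bι : Module.Basis ι ℝ Vt) (dist : ι → ι → ℕ) {M M' : ℝ → ℝ → Matrix ι ι ℝ}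
    (hMU : M 0 0 = LinearMap.toMatrix bι bι (Ah U)) (hMV : M 1 0 = LinearMap.toMatrix bι bι (Ah V))
    (hMW : M 0 1 = LinearMap.toMatrix bι bι (Ah W)) (hMZ : M 1 1 = LinearMap.toMatrix bι bι (Ah Z))
    (hM : ∀ t s i j, HasDerivAt (fun s => M s t i j) (M' s t i j) s) (hM'c : ∀ t i j, Continuous fun s => M' s t i j)
    (hne : ∀ s t, (M s t).det ≠ 0)
    {α ε δ β₀ η θ : ℝ} (hα : 0 ≤ α) (hε : 0 ≤ ε) (hδ : 0 ≤ δ) (hβ₀ : 0 ≤ β₀) (hθ : 0 ≤ θ)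
    {d d' : ι → ℕ} (hD : ∀ s x a, |M' s 1 x a| ≤ δ * Real.exp (-(θ * d a)))
    (hE : ∀ s i j, |(M s 1 - M s 0) i j| ≤ ε * Real.exp (-(θ * d' i)))
    {R : ℕ} (hsep : ∀ a c, R ≤ d a + dist a c + d' c)
    (hA : ∀ s a c, |(M s 1)⁻¹ a c| ≤ α * Real.exp (-(θ * dist a c)))
    (hB0 : ∀ s a c, |(M s 0)⁻¹ a c| ≤ β₀) (hR : ∀ s a c, |(M' s 1 - M' s 0) a c| ≤ η) :
    |(Real.log (ℓ U / b) - Real.log (ℓ V / b)) - (Real.log (ℓ W / b) - Real.log (ℓ Z / b))|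
      ≤ ε₁ + ((Fintype.card ι : ℝ) ^ 4 * α * ε * β₀ * δ * Real.exp (-(θ * R)) + (Fintype.card ι : ℝ) ^ 2 * β₀ * η) / 2 := by
  -- `ε₂` from the rectangle, read back on `LinearMap.det`
  have h₂mat := abs_fourPt_log_det_le_of_expLocalised dist hM hM'c hne hα hε hδ hβ₀ hθ hD hE hsep hA hB0 hR
  rw [hMU, hMV, hMW, hMZ, LinearMap.det_toMatrix, LinearMap.det_toMatrix, LinearMap.det_toMatrix, LinearMap.det_toMatrix] at h₂mat
  exact abs_fourPt_log_oneLoopConst_le (D := fun x => LinearMap.det (Ah x)) hc hb hℓ hP hdet h₁ h₂mat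

end Summit.QuantumFields.YangMills.Theorems.FluctuationComparisonRegPrIntLS2BetaDecayLogDet

end
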